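import Literature.AlgebraicGeometry.Resolution.RetractionBlowupTransform
import Literature.AlgebraicGeometry.Resolution.BlowupsComposition
import Literature.AlgebraicGeometry.Resolution.RegularBlowup
import Literature.AlgebraicGeometry.Resolution.BlowupsExistence
import Literature.AlgebraicGeometry.Resolution.MarkedIdealsLemmas
import Literature.AlgebraicGeometry.Resolution.KollarPushforward
import Literature.AlgebraicGeometry.Resolution.ResolutionGlue
import Literature.AlgebraicGeometry.Resolution.AffineBlowupCartier
import HarnessLib

/-!
# Crux `PatchingRelPerfect` (stmt-ResolutionOfSingularities-16161), chain w52 — programme r-d1,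
# piece D1: the DICTIONARY STEP (`DictionaryStep` of plan-1's targets E, scheme level)

[OURS · L1 W5.2 · rung tool] CHAIN.md v1.5 §2, typed target `DepthOneTargets.DictionaryStep` of
`ChainW52TargetsE.lean` (9d67ec503d849faa, l.260–282), adopted BY CONTENT with the identical binder
shape (the eight fields of `DepthOneInvariant` unbundled, in the same order, as hypotheses and as the
conclusion's conjunction), so that `dictionaryStep_holds : DepthOneTargets.DictionaryStep` is a
repackaging once the targets file lands.

One controlled step on the exceptional threefold — `τ : E' ⟶ E` a blowing up along a centre `C ⊇ 𝔟`
with `V(C)` regular and `𝔟𝒪_{E'} = C𝒪_{E'} · 𝔟'` — is matched by one blowing up of the ambient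
`X ⊃ E`: push the centre into `X` (`Ĉ = C.map i`, `Ĉ|_E = C`, `V(Ĉ) ≅ V(C)` regular), blow `X` up
along `Ĉ` (`exists_isBlowup`; regular by Liu 8.1.19 (a) `IsBlowup.isRegular_of_isRegular_subscheme`,
Noetherian by properness), compose (`IsBlowup.exists_isBlowup_comp_supported`: still cosupported in
the closed point), take the strict-transform morphism `i' = Bl_Ĉ(i) : E' ⟶ X'` (GW 13.91 (1)
`IsBlowup.strictTransformHom`; a closed immersion by GW 13.96 (2) `IsBlowup.isClosedImmersion_of_comp_eq`;
its ideal is `(σ^*𝓘_E : 𝓘_{exc})`, `IsBlowup.ker_strictTransformHom_of_isRegular`, an effective Cartier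
divisor since `𝓘_{exc} · (σ^*𝓘_E : 𝓘_{exc}) = σ^*𝓘_E` is one), and transport the FORMAT:
`σ^*K = 𝓘_{exc} · K'` with `K'` the controlled transform (BGMW 3.2.1,
`IsBlowup.comap_mul_controlledTransform_one`), `M' = σ^*M · 𝓘_{exc}`, `𝓘_{E'} ≤ K'` (colon is monotone),
and `K'|_{E'} = 𝔟'` by cancelling the effective Cartier divisor `C𝒪_{E'}` in
`C𝒪_{E'} · K'|_{E'} = 𝔟𝒪_{E'} = C𝒪_{E'} · 𝔟'` (`IsEffectiveCartier.eq_of_mul_eq_mul`). PROVED here,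
fact-free; perfectness / residue field / characteristic / excellence of `S` are used nowhere.
Nothing here is a statement of the manuscript under review.

## References

* U. Görtz, T. Wedhorn, *Algebraic Geometry I*, 2nd ed. (2020), Prop. 13.91 (1), Prop. 13.96 (2). [GortzWedhorn2020]
* E. Bierstone, D. Grigoriev, P. Milman, J. Włodarczyk, *Effective Hironaka resolution …* (2011), §3.2 Lemma 3.2.1. [BierstoneGrigorievMilmanWlodarczyk2011]
* J. Kollár, *Lectures on Resolution of Singularities* (2007), 3.30.2, (3.111) Step 3. [Kollar2007]
* Q. Liu, *Algebraic Geometry and Arithmetic Curves* (2002), Thm. 8.1.19 (a). [Liu2002]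
-/

-- `Summit.<Summit>.<Sub>.Theorems` with `Sub = Summit` (single-conjunct summit, D-0017)
set_option linter.dupNamespace false

noncomputable section

open CategoryTheory CategoryTheory.Limits AlgebraicGeometry TopologicalSpace
open Literature.AlgebraicGeometry.Resolution
open IsLocalRing

namespace Summit.ResolutionOfSingularities.ResolutionOfSingularities.Theorems

universe u

namespace DepthOne

variable {E X : Scheme.{u}} (i : E ⟶ X) [IsClosedImmersion i]

omit [IsClosedImmersion i] in
/-- The centre pushed into the ambient scheme contains the ideal of `E`: `𝓘_E ≤ C.map i`. [folklore] -/
theorem ker_le_map_centre (C : E.IdealSheafData) : i.ker ≤ C.map i :=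
  ker_le_map C i

/-- `(C.map i)|_E = C` for a closed immersion `i`. [folklore] -/
theorem comap_map_centre (C : E.IdealSheafData) : (C.map i).comap i = C :=
  comap_map_of_isClosedImmersion i C

/-- `V(C.map i) ≅ V(C)`: regularity of the pushed centre. [folklore] -/
theorem isRegular_subscheme_map (C : E.IdealSheafData) (hC : Scheme.IsRegular C.subscheme) :
    Scheme.IsRegular (C.map i).subscheme := by
  -- `C.map i = (C.subschemeι ≫ i).ker`, and a closed immersion is an isomorphism onto its image
  have h : Scheme.IsRegular (C.subschemeι ≫ i).ker.subscheme :=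
    Scheme.IsRegular.of_iso (C.subschemeι ≫ i).toImage hC
  exact h

/-- `V(𝓘_E) ≅ E`: regularity of the image subscheme of a closed immersion. [folklore] -/
theorem isRegular_subscheme_ker (hE : Scheme.IsRegular E) : Scheme.IsRegular i.ker.subscheme := by
  exact Scheme.IsRegular.of_iso i.toImage hE

/-- The support of the pushed centre lies in the image of `E`. [folklore] -/
theorem support_map_subset_range (C : E.IdealSheafData) :
    ((C.map i).support : Set X) ⊆ Set.range i.base := by
  have h1 : (C.map i).support ≤ i.ker.support :=
    Scheme.IdealSheafData.support_antitone (ker_le_map C i)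
  have h2 : (i.ker.support : Set X) = closure (Set.range i.base) := by
    rw [Scheme.Hom.support_ker]
  have h3 : closure (Set.range i.base) = Set.range i.base :=
    i.isClosedEmbedding.isClosed_range.closure_eq
  intro x hx
  have hx' : x ∈ (i.ker.support : Set X) := h1 hx
  rw [h2, h3] at hx'
  exact hx'

end DepthOne

/-- **D1 — the dictionary step** (`DepthOneTargets.DictionaryStep` of plan-1's `ChainW52TargetsE.lean`,
by content, the eight fields of `DepthOneInvariant S I E X i g 𝔟` unbundled in order): one controlled
step `τ : E' ⟶ E` (blowing up along `C ⊇ 𝔟` with `V(C)` regular, `𝔟𝒪_{E'} = C𝒪_{E'} · 𝔟'`) on the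
exceptional threefold is matched by one blowing up `σ : X' = Bl_{C.map i} X ⟶ X` of the ambient regular
scheme, and the invariant is re-established for `(E', X', Bl(i), σ ≫ g, 𝔟')`.
[cite: GortzWedhorn2020, Prop. 13.91 (1), Prop. 13.96 (2)] [cite: BierstoneGrigorievMilmanWlodarczyk2011, §3.2 Lemma 3.2.1]
[cite: Kollar2007, (3.111) Step 3] [cite: Liu2002, Thm. 8.1.19 (a)] -/
theorem dictionaryStep {S : Type u} [CommRing S] [IsRegularLocalRing S] (I : Ideal S)
    {E X : Scheme.{u}} (i : E ⟶ X) (g : X ⟶ Spec (.of S)) (𝔟 : E.IdealSheafData)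
    (hXN : IsNoetherian X) (hX : Scheme.IsRegular X) (hE : Scheme.IsRegular E)
    (hi : IsClosedImmersion i) (hiE : IsEffectiveCartier i.ker)
    (hEpt : ∀ e : E, g.base (i.base e) = IsLocalRing.closedPoint S)
    (hg : ∃ K : (Spec (.of S)).IdealSheafData, IsBlowup g K ∧
      (K.support : Set (Spec (.of S))) ⊆ {IsLocalRing.closedPoint S})
    (hfmt : ∃ M K : X.IdealSheafData, IsEffectiveCartier M ∧ i.ker ≤ K ∧ K.comap i = 𝔟 ∧
      (affineBlowup.idealSheaf I).comap g = M * K)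
    {E' : Scheme.{u}} (τ : E' ⟶ E) (C : E.IdealSheafData) (𝔟' : E'.IdealSheafData)
    (hC : Scheme.IsRegular C.subscheme) (hle : 𝔟 ≤ C) (hτ : IsBlowup τ C)
    (hctrl : 𝔟.comap τ = C.comap τ * 𝔟') :
    ∃ (X' : Scheme.{u}) (i' : E' ⟶ X') (g' : X' ⟶ Spec (.of S)),
      IsNoetherian X' ∧ Scheme.IsRegular X' ∧ Scheme.IsRegular E' ∧ IsClosedImmersion i' ∧
      IsEffectiveCartier i'.ker ∧
      (∀ e : E', g'.base (i'.base e) = IsLocalRing.closedPoint S) ∧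
      (∃ K' : (Spec (.of S)).IdealSheafData, IsBlowup g' K' ∧
        (K'.support : Set (Spec (.of S))) ⊆ {IsLocalRing.closedPoint S}) ∧
      (∃ M' K' : X'.IdealSheafData, IsEffectiveCartier M' ∧ i'.ker ≤ K' ∧ K'.comap i' = 𝔟' ∧
        (affineBlowup.idealSheaf I).comap g' = M' * K') := by
  haveI := hXN
  haveI := hi
  -- the centre pushed into `X`
  set Ch : X.IdealSheafData := C.map i with hCh
  have hkerCh : i.ker ≤ Ch := DepthOne.ker_le_map_centre i C
  have hChE : Ch.comap i = C := DepthOne.comap_map_centre i C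
  have hChreg : Scheme.IsRegular Ch.subscheme := DepthOne.isRegular_subscheme_map i C hC
  -- blow `X` up along `Ch`
  obtain ⟨X', σ, hσ⟩ := exists_isBlowup X Ch
  -- `τ` is a blowing up along `Ch|_E = C`
  have hτ' : IsBlowup τ (Ch.comap i) := by rw [hChE]; exact hτ
  -- the strict-transform morphism
  let i' : E' ⟶ X' := hσ.strictTransformHom hτ'
  have hsq : i' ≫ σ = τ ≫ i := hσ.strictTransformHom_comp hτ'
  haveI hi' : IsClosedImmersion i' := hσ.isClosedImmersion_of_comp_eq hτ' hsq
  -- `X'` is Noetherian and regular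
  haveI : IsProper σ := hσ.isProper
  haveI : IsLocallyNoetherian X' := LocallyOfFiniteType.isLocallyNoetherian σ
  haveI : CompactSpace X' := QuasiCompact.compactSpace_of_compactSpace σ
  have hX'N : IsNoetherian X' := {}
  have hX'reg : Scheme.IsRegular X' := hσ.isRegular_of_isRegular_subscheme hX hChreg
  -- `E'` is regular (blowing up the regular `E` along the regular centre `V(C)`)
  haveI : IsLocallyNoetherian E := LocallyOfFiniteType.isLocallyNoetherian i
  have hE'reg : Scheme.IsRegular E' := hτ.isRegular_of_isRegular_subscheme hE hC
  -- the ideal of the strict transform and its Cartier property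
  have hker : i'.ker = controlledTransform σ Ch i.ker 1 :=
    hσ.ker_strictTransformHom_of_isRegular hX hChreg hτ' hkerCh (DepthOne.isRegular_subscheme_ker i hE)
  have hexc : IsEffectiveCartier (Ch.comap σ) := hσ.isEffectiveCartier
  have hkerE' : IsEffectiveCartier i'.ker := by
    have h1 : Ch.comap σ * controlledTransform σ Ch i.ker 1 = i.ker.comap σ :=
      hσ.comap_mul_controlledTransform_one hkerCh
    have h2 : IsEffectiveCartier (i.ker.comap σ) := hiE.comap_of_isBlowup hσ
    rw [hker]
    rw [← h1] at h2
    exact h2.of_mul_right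
  refine ⟨X', i', σ ≫ g, hX'N, hX'reg, hE'reg, hi', hkerE', ?_, ?_, ?_⟩
  · -- `E'` lies over the closed point
    intro e
    have : (i' ≫ σ).base e = (τ ≫ i).base e := by rw [hsq]
    simp only [Scheme.Hom.comp_base, TopCat.coe_comp, Function.comp_apply] at this ⊢
    rw [this]
    exact hEpt (τ.base e)
  · -- `σ ≫ g` is a blowing up cosupported in the closed point
    obtain ⟨K, hgK, hKsupp⟩ := hg
    have hChsupp : (Ch.support : Set X) ⊆ g.base ⁻¹' {IsLocalRing.closedPoint S} := by
      intro x hx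
      obtain ⟨e, rfl⟩ := DepthOne.support_map_subset_range i C hx
      exact hEpt e
    obtain ⟨Q, hQ, hQsupp⟩ := hgK.exists_isBlowup_comp_supported g K σ Ch {IsLocalRing.closedPoint S}
      hKsupp hσ hChsupp
    exact ⟨Q, hQ, hQsupp⟩
  · -- the FORMAT
    obtain ⟨M, K, hM, hkerK, hKE, hIMK⟩ := hfmt
    have hKCh : K ≤ Ch := by
      rw [hCh, Scheme.IdealSheafData.le_map_iff_comap_le, hKE]
      exact hle
    let K' : X'.IdealSheafData := controlledTransform σ Ch K 1
    have hKK' : Ch.comap σ * K' = K.comap σ := hσ.comap_mul_controlledTransform_one hKCh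
    refine ⟨M.comap σ * Ch.comap σ, K', (hM.comap_of_isBlowup hσ).mul hexc, ?_, ?_, ?_⟩
    · -- `𝓘_{E'} ≤ K'`
      rw [hker]
      exact colon_mono_left (Scheme.IdealSheafData.comap_mono (f := σ) hkerK) _
    · -- `K'|_{E'} = 𝔟'`: cancel the effective Cartier divisor `C𝒪_{E'}`
      apply hτ.isEffectiveCartier.eq_of_mul_eq_mul
      have h1 : (Ch.comap σ).comap i' = C.comap τ := by
        rw [← Scheme.IdealSheafData.comap_comp, hsq, Scheme.IdealSheafData.comap_comp, hChE]
      have h2 : (K.comap σ).comap i' = 𝔟.comap τ := by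
        rw [← Scheme.IdealSheafData.comap_comp, hsq, Scheme.IdealSheafData.comap_comp, hKE]
      rw [← hctrl, ← h2, ← hKK', comap_mul, h1]
    · -- `I𝒪_{X'} = σ^*M · 𝓘_{exc} · K'`
      rw [Scheme.IdealSheafData.comap_comp, hIMK, comap_mul, ← hKK', mul_assoc]

end Summit.ResolutionOfSingularities.ResolutionOfSingularities.Theorems

end
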